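import Summits.AtomisticToContinuum.Crystallization.Theorems.SquareWellLayerCakeGapTwelveToBarlowUniformSpacingSelectionHull

/-!
# `stub_uniformSpacingSelection` (crux `GapTwelveToBarlow`, stmt-AtomisticToContinuum-15807), bridge side, II:
# bad layers of layered windows pass to a layered hull element

Second formal piece of the hull ⇒ a.e. bridge `hullBadLayers_to_ae` (`uniformSpacingSelection-REPORT.md`):
`hull_badLayers_of_windows` (anchor `stub_hullBadLayersOfWindows`).  Fix `L, K : ℕ`, `δ > 0` and a count
`c`.  Suppose that for every scale `n` and tolerance `ε₁ > 0`, frequently in `N`, some translate of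
`x N` is two-way `ε₁`-matched on `‖·‖ ≤ n` with the layered set of normalised data `(A, a, s, z)`
(`a ∈ [47/50, 1]`, `IsHaggSeq s`, increments in the box, `z 0 ∈ [−17a/20, 0]`) having at least `c` base
layers `m₀ ∈ [−L, L]` around which the heights are NOT `δ`-close to an arithmetic progression on
`|m − m₀| ≤ K`.  Then some layered set `A₀(S(a₀, s₀, z₀))` in the HULL of `x` has at least `c` base layers
in `[−L, L]` around which the heights are not `δ/2`-close to arithmetic on `|m − m₀| ≤ K`.

Proof: diagonal sequence of windows at scales `(k, 1/(k+1))` (`Filter.extraction_forall_of_frequently`);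
the data `(A_k, s_k, (a_k, z_k), 𝟙_{B_k})` (bad set `B_k ⊆ [−L, L]` coded in `ℤ → Bool`) live in the compact
set `Isom × {±1}^ℤ × {(a, z) normalised} × (ℤ → Bool)` (`LayeredHull.ext_isCompact_isometries/words`,
`sel_isCompact_spacingHeights`, Tychonoff), hence have a cluster point `(A₀, s₀, (a₀, z₀), 𝟙_{B₀})`;
`hull_of_approximants` (part I) puts `A₀(S(a₀, s₀, z₀))` in the hull; frequently the data are close to the
cluster point AND `B_k = B₀`, so `#B₀ ≥ c`, and a base layer bad at precision `δ` for heights `δ/8`-close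
to `z₀` on the window is bad at precision `δ/2` for `z₀` (`sel_bad_of_close`: goodness is a closed
condition, so badness survives the limit after halving `δ`).
-/

noncomputable section

namespace Summit.AtomisticToContinuum.Crystallization.Theorems.SquareWellLayerCakeGapTwelveToBarlow

open scoped BigOperators
open Filter Topology Literature.MathematicalPhysics.StatisticalMechanics
open Summit.AtomisticToContinuum.Crystallization.Theorems.LayeredHull


/-! ## Compactness of the normalised (spacing, heights) data -/

/-- Normalised (spacing, heights) data — `a ∈ [47/50, 1]`, `z 0 ∈ [−17a/20, 0]`, increments in
`[39a/50, 17a/20]` — form a compact subset of `ℝ × (ℤ → ℝ)` (closed, inside a product of compact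
intervals by `LayeredHull.ext_abs_height_le`). [folklore] -/
theorem sel_isCompact_spacingHeights :
    IsCompact {q : ℝ × (ℤ → ℝ) | (47 / 50 ≤ q.1 ∧ q.1 ≤ 1) ∧ (-(17 / 20 * q.1) ≤ q.2 0 ∧ q.2 0 ≤ 0) ∧
      ∀ m : ℤ, 39 / 50 * q.1 ≤ q.2 (m + 1) - q.2 m ∧ q.2 (m + 1) - q.2 m ≤ 17 / 20 * q.1} := by
  refine IsCompact.of_isClosed_subset ((isCompact_Icc : IsCompact (Set.Icc (47 / 50 : ℝ) 1)).prod
    (isCompact_univ_pi fun m : ℤ => (isCompact_Icc : IsCompact (Set.Icc (-(17 / 20 * (|(m : ℝ)| + 1)))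
      (17 / 20 * (|(m : ℝ)| + 1)))))) ?_ ?_
  · simp only [Set.setOf_and, Set.setOf_forall]
    refine ((isClosed_le ?_ ?_).inter (isClosed_le ?_ ?_)).inter
      (((isClosed_le ?_ ?_).inter (isClosed_le ?_ ?_)).inter
        (isClosed_iInter fun m => (isClosed_le ?_ ?_).inter (isClosed_le ?_ ?_)))
    all_goals fun_prop
  · rintro ⟨a, z⟩ ⟨⟨ha, ha1⟩, hz0, hz⟩
    dsimp only at ha ha1 hz0 hz
    refine Set.mk_mem_prod ⟨ha, ha1⟩ (Set.mem_univ_pi.2 fun m => ?_)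
    have h1 := ext_abs_height_le hz hz0 m
    push_cast at h1
    have hm0 : (0 : ℝ) ≤ |(m : ℝ)| + 1 := by positivity
    have h2 : |z m| ≤ 17 / 20 * (|(m : ℝ)| + 1) :=
      h1.trans (by nlinarith [mul_le_mul_of_nonneg_right ha1 hm0])
    exact abs_le.1 h2

/-! ## Neighbourhoods of a data point -/

/-- Closeness to a data point on finitely many coordinates is a neighbourhood. [folklore] -/
theorem sel_eventually_close (d₀ : ((EuclideanSpace ℝ (Fin 3) →L[ℝ] EuclideanSpace ℝ (Fin 3)) × ((ℤ → ℤ) × ((ℝ × (ℤ → ℝ)) × (ℤ → Bool))))) (F : Finset ℤ) (ρ : ℝ) (hρ : 0 < ρ) :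
    ∀ᶠ e in 𝓝 d₀, dist e.1 d₀.1 ≤ ρ ∧ (∀ m ∈ F, e.2.1 m = d₀.2.1 m) ∧ dist e.2.2.1.1 d₀.2.2.1.1 ≤ ρ ∧
      (∀ m ∈ F, dist (e.2.2.1.2 m) (d₀.2.2.1.2 m) ≤ ρ) ∧ (∀ m ∈ F, e.2.2.2 m = d₀.2.2.2 m) := by
  refine Eventually.and ?_ (Eventually.and ?_ (Eventually.and ?_ (Eventually.and ?_ ?_)))
  · exact (continuous_fst.tendsto d₀).eventually (Metric.closedBall_mem_nhds _ hρ)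
  · refine (eventually_all_finset _).2 fun m _ => ?_
    have hc : Continuous fun e : ((EuclideanSpace ℝ (Fin 3) →L[ℝ] EuclideanSpace ℝ (Fin 3)) × ((ℤ → ℤ) × ((ℝ × (ℤ → ℝ)) × (ℤ → Bool)))) => e.2.1 m := by fun_prop
    exact (hc.tendsto d₀).eventually (show ∀ᶠ y in 𝓝 (d₀.2.1 m), y = d₀.2.1 m by simp [nhds_discrete])
  · have hc : Continuous fun e : ((EuclideanSpace ℝ (Fin 3) →L[ℝ] EuclideanSpace ℝ (Fin 3)) × ((ℤ → ℤ) × ((ℝ × (ℤ → ℝ)) × (ℤ → Bool)))) => e.2.2.1.1 := by fun_prop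
    exact (hc.tendsto d₀).eventually (Metric.closedBall_mem_nhds _ hρ)
  · refine (eventually_all_finset _).2 fun m _ => ?_
    have hc : Continuous fun e : ((EuclideanSpace ℝ (Fin 3) →L[ℝ] EuclideanSpace ℝ (Fin 3)) × ((ℤ → ℤ) × ((ℝ × (ℤ → ℝ)) × (ℤ → Bool)))) => e.2.2.1.2 m := by fun_prop
    exact (hc.tendsto d₀).eventually (Metric.closedBall_mem_nhds _ hρ)
  · refine (eventually_all_finset _).2 fun m _ => ?_
    have hc : Continuous fun e : ((EuclideanSpace ℝ (Fin 3) →L[ℝ] EuclideanSpace ℝ (Fin 3)) × ((ℤ → ℤ) × ((ℝ × (ℤ → ℝ)) × (ℤ → Bool)))) => e.2.2.2 m := by fun_prop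
    exact (hc.tendsto d₀).eventually (show ∀ᶠ y in 𝓝 (d₀.2.2.2 m), y = d₀.2.2.2 m by simp [nhds_discrete])

/-! ## Badness survives the limit after halving `δ` -/

/-- If the heights `z` are `δ/8`-close to `z₀` on the window `[m₀ − K, m₀ + K]` and `m₀` is a bad base
layer of `z` at precision `δ`, then `m₀` is a bad base layer of `z₀` at precision `δ/2`. [folklore] -/
theorem sel_bad_of_close {z z₀ : ℤ → ℝ} {m₀ : ℤ} {K : ℕ} {δ : ℝ}
    (hclose : ∀ m ∈ Finset.Icc (m₀ - K) (m₀ + K), |z m - z₀ m| ≤ δ / 8)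
    (hbad : ¬ ∃ h : ℝ, ∀ m : ℤ, |(m : ℝ) - m₀| ≤ K → |z m - z m₀ - ((m : ℝ) - m₀) * h| ≤ δ) :
    ¬ ∃ h : ℝ, ∀ m : ℤ, |(m : ℝ) - m₀| ≤ K → |z₀ m - z₀ m₀ - ((m : ℝ) - m₀) * h| ≤ δ / 2 := by
  rintro ⟨h, hh⟩
  apply hbad
  refine ⟨h, fun m hm => ?_⟩
  have h3 := hh m hm
  rw [abs_le] at hm
  obtain ⟨hl, hr⟩ := hm
  have hlo : m₀ - (K : ℤ) ≤ m := by
    have : ((m₀ - (K : ℤ) : ℤ) : ℝ) ≤ m := by push_cast; linarith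
    exact_mod_cast this
  have hhi : m ≤ m₀ + (K : ℤ) := by
    have : ((m : ℤ) : ℝ) ≤ ((m₀ + (K : ℤ) : ℤ) : ℝ) := by push_cast; linarith
    exact_mod_cast this
  have h1 := hclose m (Finset.mem_Icc.2 ⟨hlo, hhi⟩)
  have h2 := hclose m₀ (Finset.mem_Icc.2 ⟨by omega, by omega⟩)
  rw [abs_le] at h1 h2 h3 ⊢
  constructor <;> linarith [h1.1, h1.2, h2.1, h2.2, h3.1, h3.2]

/-! ## Bad layers of windows pass to the hull -/

/-- **Bad layers of layered windows pass to a layered hull element.**  If for every scale `n` and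
tolerance `ε₁ > 0`, frequently in `N`, a translate of `x N` is two-way `ε₁`-matched on `‖·‖ ≤ n` with the
layered set of normalised data `(A, a, s, z)` having at least `c` base layers in `[−L, L]` that are bad
at precision `δ` and range `K`, then some layered set in the hull of `x` (data `a₀ ∈ [47/50, 1]`,
`IsHaggSeq s₀`, increments of `z₀` in the box) has at least `c` base layers in `[−L, L]` that are bad at
precision `δ/2` and range `K`. [folklore] -/
theorem hull_badLayers_of_windows (x : (N : ℕ) → (Fin N → (EuclideanSpace ℝ (Fin 3)))) (L K c : ℕ) (δ : ℝ) (hδ : 0 < δ)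
    (hwin : ∀ (n : ℕ) (ε₁ : ℝ), 0 < ε₁ → ∃ᶠ N in atTop,
      ∃ (t : (EuclideanSpace ℝ (Fin 3))) (A : (EuclideanSpace ℝ (Fin 3)) →ₗᵢ[ℝ] (EuclideanSpace ℝ (Fin 3))) (a : ℝ) (s : ℤ → ℤ) (z : ℤ → ℝ),
        47 / 50 ≤ a ∧ a ≤ 1 ∧ IsHaggSeq s ∧
        (∀ m : ℤ, 39 / 50 * a ≤ z (m + 1) - z m ∧ z (m + 1) - z m ≤ 17 / 20 * a) ∧
        (-(17 / 20 * a) ≤ z 0 ∧ z 0 ≤ 0) ∧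
        (let S : Set (EuclideanSpace ℝ (Fin 3)) := {p | ∃ m i j : ℤ, p = A (((i : ℝ) • triangularVec₁ a) +
          ((j : ℝ) • triangularVec₂ a) + ((haggLabel s m : ℝ) • barlowOffset a) + (z m • layerNormal 1))};
          (∀ p ∈ S, ‖p‖ ≤ n → ∃ i : Fin N, dist (x N i + t) p ≤ ε₁) ∧
          (∀ i : Fin N, ‖x N i + t‖ ≤ n → ∃ p ∈ S, dist (x N i + t) p ≤ ε₁)) ∧
        ∃ B : Finset ℤ, B ⊆ Finset.Icc (-(L : ℤ)) L ∧ c ≤ B.card ∧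
          ∀ m₀ ∈ B, ¬ ∃ h : ℝ, ∀ m : ℤ, |(m : ℝ) - m₀| ≤ K → |z m - z m₀ - ((m : ℝ) - m₀) * h| ≤ δ) :
    ∃ (A₀ : (EuclideanSpace ℝ (Fin 3)) →ₗᵢ[ℝ] (EuclideanSpace ℝ (Fin 3))) (a₀ : ℝ) (s₀ : ℤ → ℤ) (z₀ : ℤ → ℝ), 47 / 50 ≤ a₀ ∧ a₀ ≤ 1 ∧ IsHaggSeq s₀ ∧
      (∀ m : ℤ, 39 / 50 * a₀ ≤ z₀ (m + 1) - z₀ m ∧ z₀ (m + 1) - z₀ m ≤ 17 / 20 * a₀) ∧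
      (let S₀ : Set (EuclideanSpace ℝ (Fin 3)) := {p | ∃ m i j : ℤ, p = A₀ (((i : ℝ) • triangularVec₁ a₀) +
          ((j : ℝ) • triangularVec₂ a₀) + ((haggLabel s₀ m : ℝ) • barlowOffset a₀) + (z₀ m • layerNormal 1))};
        ∀ R ε : ℝ, 0 < ε → ∃ᶠ N in atTop, ∃ t : (EuclideanSpace ℝ (Fin 3)),
          (∀ p ∈ S₀, ‖p‖ ≤ R → ∃ i : Fin N, dist (x N i + t) p ≤ ε) ∧
          (∀ i : Fin N, ‖x N i + t‖ ≤ R → ∃ p ∈ S₀, dist (x N i + t) p ≤ ε)) ∧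
      ∃ B : Finset ℤ, B ⊆ Finset.Icc (-(L : ℤ)) L ∧ c ≤ B.card ∧
        ∀ m₀ ∈ B, ¬ ∃ h : ℝ, ∀ m : ℤ, |(m : ℝ) - m₀| ≤ K →
          |z₀ m - z₀ m₀ - ((m : ℝ) - m₀) * h| ≤ δ / 2 := by
  classical
  -- Step 1: a diagonal sequence of windows at scales `(k, 1/(k+1))`
  have key := fun k : ℕ => hwin k (1 / ((k : ℝ) + 1)) (by positivity)
  obtain ⟨φ, hφ, hφW⟩ := extraction_forall_of_frequently key
  choose t A a s z ha ha1 hs hz hz0 hM hB using hφW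
  choose B hBsub hBcard hBbad using hB
  -- Step 2: a cluster point of the data (with the coded bad sets) in the compact data space
  set u : ℕ → ((EuclideanSpace ℝ (Fin 3) →L[ℝ] EuclideanSpace ℝ (Fin 3)) × ((ℤ → ℤ) × ((ℝ × (ℤ → ℝ)) × (ℤ → Bool)))) := fun k =>
    ((A k).toContinuousLinearMap, (s k, ((a k, z k), fun m => decide (m ∈ B k)))) with hu
  have hKc := ext_isCompact_isometries.prod (ext_isCompact_words.prod
    (sel_isCompact_spacingHeights.prod (isCompact_univ : IsCompact (Set.univ : Set (ℤ → Bool)))))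
  have hdK : ∀ k, u k ∈ {L : (EuclideanSpace ℝ (Fin 3)) →L[ℝ] (EuclideanSpace ℝ (Fin 3)) | ∀ v, ‖L v‖ = ‖v‖} ×ˢ
      ((Set.pi Set.univ fun _ : ℤ => ({1, -1} : Set ℤ)) ×ˢ
        ({q : ℝ × (ℤ → ℝ) | (47 / 50 ≤ q.1 ∧ q.1 ≤ 1) ∧ (-(17 / 20 * q.1) ≤ q.2 0 ∧ q.2 0 ≤ 0) ∧
          ∀ m : ℤ, 39 / 50 * q.1 ≤ q.2 (m + 1) - q.2 m ∧ q.2 (m + 1) - q.2 m ≤ 17 / 20 * q.1} ×ˢ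
          (Set.univ : Set (ℤ → Bool)))) := fun k =>
    Set.mk_mem_prod (fun v => (A k).norm_map v) (Set.mk_mem_prod
      (Set.mem_univ_pi.2 fun i => by rcases hs k i with h | h <;> simp [h])
      (Set.mk_mem_prod ⟨⟨ha k, ha1 k⟩, hz0 k, hz k⟩ (Set.mem_univ _)))
  obtain ⟨⟨L₀, s₀, ⟨a₀, z₀⟩, b₀⟩, hmem, hcl⟩ := hKc.exists_mapClusterPt (f := atTop) (u := u)
    (tendsto_principal.2 (Eventually.of_forall hdK))
  have hL₀ : ∀ v, ‖L₀ v‖ = ‖v‖ := hmem.1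
  have hs₀ : IsHaggSeq s₀ := fun i => by simpa using Set.mem_univ_pi.1 hmem.2.1 i
  obtain ⟨⟨ha₀, ha₀1⟩, hz₀0, hz₀⟩ := hmem.2.2.1
  rw [mapClusterPt_iff_frequently] at hcl
  let A₀ : (EuclideanSpace ℝ (Fin 3)) →ₗᵢ[ℝ] (EuclideanSpace ℝ (Fin 3)) := ⟨(L₀ : (EuclideanSpace ℝ (Fin 3)) →ₗ[ℝ] (EuclideanSpace ℝ (Fin 3))), hL₀⟩
  have hA₀ : ∀ v, A₀ v = L₀ v := fun v => rfl
  -- the limiting bad set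
  set B₀ : Finset ℤ := (Finset.Icc (-(L : ℤ)) L).filter fun m => b₀ m = true with hB₀
  -- Step 3: frequently, the data are close to the cluster point AND the bad set is `B₀`
  have hfreq : ∀ (F : Finset ℤ) (ρ : ℝ), 0 < ρ → ∃ᶠ k in atTop,
      (dist (A k).toContinuousLinearMap L₀ ≤ ρ ∧ (∀ m ∈ F, s k m = s₀ m) ∧ dist (a k) a₀ ≤ ρ ∧
        (∀ m ∈ F, dist (z k m) (z₀ m) ≤ ρ)) ∧ B k = B₀ := by
    intro F ρ hρ
    have hU := sel_eventually_close (L₀, (s₀, ((a₀, z₀), b₀))) (F ∪ Finset.Icc (-(L : ℤ)) L) ρ hρ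
    refine (hcl _ hU).mono fun k hk => ?_
    obtain ⟨h1, h2, h3, h4, h5⟩ := hk
    refine ⟨⟨h1, fun m hm => h2 m (Finset.mem_union_left _ hm), h3,
      fun m hm => h4 m (Finset.mem_union_left _ hm)⟩, ?_⟩
    ext m
    rw [hB₀, Finset.mem_filter]
    constructor
    · intro hmB
      have hmI : m ∈ Finset.Icc (-(L : ℤ)) L := hBsub k hmB
      have h5m : decide (m ∈ B k) = b₀ m := h5 m (Finset.mem_union_right _ hmI)
      rw [decide_eq_true hmB] at h5m
      exact ⟨hmI, h5m.symm⟩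
    · rintro ⟨hmI, hb⟩
      have h5m : decide (m ∈ B k) = b₀ m := h5 m (Finset.mem_union_right _ hmI)
      rw [hb] at h5m
      exact of_decide_eq_true h5m
  refine ⟨A₀, a₀, s₀, z₀, ha₀, ha₀1, hs₀, hz₀, ?_, B₀, Finset.filter_subset _ _, ?_, ?_⟩
  · -- Step 4: the cluster point is in the hull (`hull_of_approximants`)
    refine hull_of_approximants x A₀ a₀ ha₀ ha₀1 s₀ z₀ hz₀ hz₀0 fun M ρ hρ R ε hε => ?_
    obtain ⟨k₀, hk₀R, hk₀ε⟩ : ∃ k₀ : ℕ, R ≤ k₀ ∧ 1 / ((k₀ : ℝ) + 1) ≤ ε := by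
      obtain ⟨k₀, hk₀⟩ := exists_nat_ge (max R (1 / ε))
      refine ⟨k₀, (le_max_left _ _).trans hk₀, ?_⟩
      have h2 : 1 / ε ≤ k₀ := (le_max_right _ _).trans hk₀
      rw [div_le_iff₀ hε] at h2
      rw [div_le_iff₀ (by positivity)]
      nlinarith
    have hfr := hfreq (Finset.Icc (-(M : ℤ)) M) ρ hρ
    rw [frequently_atTop]
    intro Nmin
    have hev : ∀ᶠ k in atTop, k₀ ≤ k ∧ Nmin ≤ φ k :=
      (eventually_ge_atTop k₀).and (hφ.tendsto_atTop.eventually_ge_atTop Nmin)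
    obtain ⟨k, ⟨⟨hkA, hks, hka, hkz⟩, -⟩, hk₀, hkN⟩ := (hfr.and_eventually hev).exists
    refine ⟨φ k, hkN, t k, A k, a k, s k, z k, ha k, ha1 k, ?_, hz k, hz0 k, ?_, ?_, ?_, ?_⟩
    · rwa [Real.dist_eq] at hka
    · exact fun m hm => hks m (Finset.mem_Icc.2 (abs_le.1 hm))
    · intro m hm
      rw [← Real.dist_eq]
      exact hkz m (Finset.mem_Icc.2 (abs_le.1 hm))
    · intro v
      rw [hA₀, show A k v - L₀ v = ((A k).toContinuousLinearMap - L₀) v from rfl]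
      rw [dist_eq_norm] at hkA
      exact (ContinuousLinearMap.le_opNorm _ _).trans (mul_le_mul_of_nonneg_right hkA (norm_nonneg _))
    · have hmk := hM k
      dsimp only at hmk ⊢
      have hkR : R ≤ (k : ℝ) := hk₀R.trans (by exact_mod_cast hk₀)
      have hkε : 1 / ((k : ℝ) + 1) ≤ ε := by
        refine le_trans (one_div_le_one_div_of_le (by positivity) ?_) hk₀ε
        have : (k₀ : ℝ) ≤ k := by exact_mod_cast hk₀
        linarith
      exact ext_match_mono (x (φ k)) (t k) _ hkR hkε hmk
  · -- Step 5: `#B₀ ≥ c`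
    obtain ⟨k, -, hk⟩ := (hfreq ∅ 1 one_pos).exists
    rw [← hk]
    exact hBcard k
  · -- Step 6: badness of `z₀` at precision `δ/2` on `B₀`
    intro m₀ hm₀
    obtain ⟨k, ⟨-, -, -, hkz⟩, hk⟩ := (hfreq (Finset.Icc (m₀ - K) (m₀ + K)) (δ / 8) (by positivity)).exists
    have hm₀k : m₀ ∈ B k := by rw [hk]; exact hm₀
    exact sel_bad_of_close (fun m hm => by rw [← Real.dist_eq]; exact hkz m hm) (hBbad k m₀ hm₀k)

/-- **Anchor (registered sub-goal form of `hull_badLayers_of_windows`, closed statement).**  Bad base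
layers (precision `δ`, range `K`, at least `c` of them in `[−L, L]`) of normalised layered windows of
`x` at every scale pass, at precision `δ/2`, to a layered set in the hull of `x`. [folklore] -/
theorem stub_hullBadLayersOfWindows :
    ∀ (x : (N : ℕ) → (Fin N → EuclideanSpace ℝ (Fin 3))) (L K c : ℕ) (δ : ℝ), 0 < δ →
      (∀ (n : ℕ) (ε₁ : ℝ), 0 < ε₁ → ∃ᶠ N in atTop,
        ∃ (t : EuclideanSpace ℝ (Fin 3)) (A : EuclideanSpace ℝ (Fin 3) →ₗᵢ[ℝ] EuclideanSpace ℝ (Fin 3))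
          (a : ℝ) (s : ℤ → ℤ) (z : ℤ → ℝ),
          47 / 50 ≤ a ∧ a ≤ 1 ∧ IsHaggSeq s ∧
          (∀ m : ℤ, 39 / 50 * a ≤ z (m + 1) - z m ∧ z (m + 1) - z m ≤ 17 / 20 * a) ∧
          (-(17 / 20 * a) ≤ z 0 ∧ z 0 ≤ 0) ∧
          (let S : Set (EuclideanSpace ℝ (Fin 3)) := {p | ∃ m i j : ℤ, p = A (((i : ℝ) • triangularVec₁ a) +
            ((j : ℝ) • triangularVec₂ a) + ((haggLabel s m : ℝ) • barlowOffset a) + (z m • layerNormal 1))};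
            (∀ p ∈ S, ‖p‖ ≤ n → ∃ i : Fin N, dist (x N i + t) p ≤ ε₁) ∧
            (∀ i : Fin N, ‖x N i + t‖ ≤ n → ∃ p ∈ S, dist (x N i + t) p ≤ ε₁)) ∧
          ∃ B : Finset ℤ, B ⊆ Finset.Icc (-(L : ℤ)) L ∧ c ≤ B.card ∧
            ∀ m₀ ∈ B, ¬ ∃ h : ℝ, ∀ m : ℤ, |(m : ℝ) - m₀| ≤ K →
              |z m - z m₀ - ((m : ℝ) - m₀) * h| ≤ δ) →
      ∃ (A₀ : EuclideanSpace ℝ (Fin 3) →ₗᵢ[ℝ] EuclideanSpace ℝ (Fin 3)) (a₀ : ℝ) (s₀ : ℤ → ℤ) (z₀ : ℤ → ℝ),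
        47 / 50 ≤ a₀ ∧ a₀ ≤ 1 ∧ IsHaggSeq s₀ ∧
        (∀ m : ℤ, 39 / 50 * a₀ ≤ z₀ (m + 1) - z₀ m ∧ z₀ (m + 1) - z₀ m ≤ 17 / 20 * a₀) ∧
        (let S₀ : Set (EuclideanSpace ℝ (Fin 3)) := {p | ∃ m i j : ℤ, p = A₀ (((i : ℝ) • triangularVec₁ a₀) +
            ((j : ℝ) • triangularVec₂ a₀) + ((haggLabel s₀ m : ℝ) • barlowOffset a₀) + (z₀ m • layerNormal 1))};
          ∀ R ε : ℝ, 0 < ε → ∃ᶠ N in atTop, ∃ t : EuclideanSpace ℝ (Fin 3),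
            (∀ p ∈ S₀, ‖p‖ ≤ R → ∃ i : Fin N, dist (x N i + t) p ≤ ε) ∧
            (∀ i : Fin N, ‖x N i + t‖ ≤ R → ∃ p ∈ S₀, dist (x N i + t) p ≤ ε)) ∧
        ∃ B : Finset ℤ, B ⊆ Finset.Icc (-(L : ℤ)) L ∧ c ≤ B.card ∧
          ∀ m₀ ∈ B, ¬ ∃ h : ℝ, ∀ m : ℤ, |(m : ℝ) - m₀| ≤ K →
            |z₀ m - z₀ m₀ - ((m : ℝ) - m₀) * h| ≤ δ / 2 :=
  fun x L K c δ hδ hwin => hull_badLayers_of_windows x L K c δ hδ hwin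

end Summit.AtomisticToContinuum.Crystallization.Theorems.SquareWellLayerCakeGapTwelveToBarlow

end
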